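import Literature.NumberTheory.EllipticCurves.GreenbergVatsal2000.UnramifiedOutsideFinite
import Literature.NumberTheory.GaloisRepresentations.LocalGaloisGroupProofs
import Summits.BirchSwinnertonDyer.BirchSwinnertonDyer.Theorems.TwoAdicConverseOrdLambdaHalfAtTwoGreenbergWbarTwist
import HarnessLib

/-!
# `S₀`-imprimitive from primitive: for a TRIVIAL-action module over the top of a `ℤ_p`-extension, finiteness of the
# `p`-torsion of Greenberg–Vatsal's datum Selmer group passes from `S₀ = ∅` to any finite `S₀` whose places `𝔮 ∤ p`
# are FINITELY DECOMPOSED and carry finitely many `p`-torsion inertia characters (crux O2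
# `BDPSelmerLowerDivisibilityAtTwo`, stmt-BirchSwinnertonDyer-24728; line `split_prime_line_finite_two`, piece P4)

Helper file `--supports stmt-BirchSwinnertonDyer-24728` (seat `bsd-2adic-t42` GEN 36). THEOREMS ONLY: no definition,
no named fact, no instance, no `sorry`; nothing about any elliptic curve is asserted; O2 / 19556 / 19218 stay OPEN;
BSD is proved for no curve.

## What (the "elementary glue" of the lead's truth audit, STATUS 2026-08-30T12:12Z, in the kernel)

The v7 stub P4 `TrivialCharSplitLineFiniteAt K` asks, for EVERY finite `S₀`, that the `S₀`-imprimitive BDP-type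
Selmer set of the trivial character over the `v`-ramified `ℤ₂`-line have finite `2`-torsion; the print facts
(Oukhaba–Viguié 2016 Thm. 1.2 + Greenberg 1978 §4, typed in `Literature/NumberTheory/IwasawaTheory/`) give the
`S₀ = ∅` case. This file proves the passage `∅ ⇝ S₀` for ANY number field `K`, ANY `ℤ_p`-extension `κ`
(`H = ker κ = Gal(K̄/K_∞)`), ANY discrete `Γ_K`-module `M` with TRIVIAL action, ANY Greenberg data `L` above `p`:

* §1 the HOM PICTURE (trivial action: `H¹(H, M) = Hom_cont(H, M)`, no coboundaries): cocycles are additive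
  (tree `TwoAdicGreenbergCotorsion.cocycle_mul_of_trivial`), a class has ONE cocycle (`cocycle_eq_of_oneCocycleClass_eq`), and
  `conj_σ [z] ∈ unramifiedKer H M 𝔮 ↔ z` kills `σ⁻¹ (H ∩ I_𝔮) σ` (`conjH1_mem_unramifiedKer_iff_forall_eq_zero`);
* §2 the condition at `σ` only depends on the coset `(D_𝔮 H) σ` (`forall_eq_zero_of_mem_sup_mul`: `I_𝔮 ⊴ D_𝔮`,
  `H ⊴ Γ_K`, and an additive `z` is invariant under `H`-conjugation);
* §3 **`finite_pTorsion_datumSelmer_of_empty`**: if every `𝔮 ∈ S₀`, `𝔮 ∤ p`, is finitely decomposed in `K_∞`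
  (`(decomp 𝔮 ⊔ ker κ).FiniteIndex`) and carries finitely many continuous additive `p`-torsion maps
  `H ∩ I_𝔮 → M`, then `S^{∅}_M(K_∞)[p]` finite ⟹ `S^{S₀}_M(K_∞)[p]` finite: the additive map
  `c ↦ (y ↦ z_c(τ⁻¹ y τ))_{𝔮 ∈ S₀', τ ∈ (D_𝔮H)\Γ_K}` has finite image and its kernel on `S^{S₀}[p]` lies in
  `S^{∅}[p]` (counting dévissage `finite_of_finite_image_of_finite_sub`);
* §4 the local supply: for `I_𝔮 ≤ H` (`κ` unramified at `𝔮`), the finiteness of those maps on `H ∩ I_𝔮` follows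
  from the finiteness of the continuous additive `p`-torsion maps on the LOCAL inertia group `I_{K_𝔮}`
  (`finite_torsionMaps_inertiaIn_of_local`), which is the tree's `TameInertiaTorsionHomsFiniteProofs` (tame
  inertia is pro-cyclic; supplied by name by the consumer).

References: [GreenbergVatsal2000] §2 pp. 16–17; [SerreGaloisCohomology1997] I §2.5, I §5.1; [SerreLocalFields1979]
IV §2; [NeukirchANT1999] I §9; node card `Cruxes/BDPSelmerLowerDivisibilityAtTwo/Lines/split_prime_line_finite_two.md` §4.
-/

-- D-0017: single-problem summit, the namespace repeats the problem name by design.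
set_option linter.dupNamespace false
set_option autoImplicit false

noncomputable section

open scoped Classical Pointwise

open NumberField IsDedekindDomain Field
open Literature.NumberTheory.GaloisRepresentations Literature.NumberTheory.EllipticCurves
  Literature.NumberTheory.EllipticCurves.GreenbergSelmer Literature.NumberTheory.EllipticCurves.GreenbergVatsal2000

namespace Summit.BirchSwinnertonDyer.BirchSwinnertonDyer.Theorems.TwoAdicBDPTrivialCharLine

/-! ## §0 Counting dévissage -/

/-- **Counting dévissage**: a subtraction-closed set `S` on which an additive map `f` takes finitely many values and
whose elements killed by `f` lie in a finite set is finite (`S ⊆ ⋃_{w ∈ f(S)} (s_w + F₀)`). [folklore] -/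
theorem finite_of_finite_image_of_finite_sub {A B : Type*} [AddCommGroup A] [AddCommGroup B] (f : A →+ B)
    {S F₀ : Set A} (hsub : ∀ a ∈ S, ∀ b ∈ S, a - b ∈ S) (himg : (f '' S).Finite)
    (hF₀ : F₀.Finite) (hker : ∀ a ∈ S, f a = 0 → a ∈ F₀) : S.Finite := by
  have hsec : ∀ w ∈ f '' S, ∃ s ∈ S, f s = w := fun w hw ↦ by
    obtain ⟨s, hs, rfl⟩ := hw
    exact ⟨s, hs, rfl⟩
  choose! g hgS hgf using hsec
  refine ((himg.prod hF₀).image fun q : B × A ↦ g q.1 + q.2).subset fun s hs ↦ ?_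
  have hfs : f s ∈ f '' S := ⟨s, hs, rfl⟩
  refine ⟨(f s, s - g (f s)), ⟨hfs, hker _ (hsub s hs _ (hgS _ hfs)) ?_⟩, ?_⟩
  · rw [map_sub, hgf _ hfs, sub_self]
  · change g (f s) + (s - g (f s)) = s
    abel

/-! ## §1 The Hom picture of `H¹(H, M)` for a trivial-action module -/

section HomPicture

variable {K : Type} [Field K] [NumberField K] (H : Subgroup (absoluteGaloisGroup K)) [H.Normal]
  {M : Type} [AddCommGroup M] [DistribMulAction (absoluteGaloisGroup K) M] [TopologicalSpace M]
  [DiscreteTopology M]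

omit [NumberField K] [H.Normal] in
/-- For a TRIVIAL-action module two cocycles with the same class are EQUAL (the only coboundary is `0`).
[cite: SerreGaloisCohomology1997, I §5.1] -/
theorem cocycle_eq_of_oneCocycleClass_eq (htriv : ∀ (σ : absoluteGaloisGroup K) (m : M), σ • m = m)
    {z z' : contOneCocycles (discreteTopRep H M)}
    (h : oneCocycleClass (discreteTopRep H M) z = oneCocycleClass (discreteTopRep H M) z') : z = z' := by
  have h0 : oneCocycleClass (discreteTopRep H M) (z - z') = 0 := by rw [oneCocycleClass_sub, h, sub_self]
  rw [oneCocycleClass_eq_zero_iff] at h0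
  obtain ⟨v, hv⟩ := h0
  rw [← sub_eq_zero]
  apply Subtype.ext
  ext x
  have hx := hv x
  rw [discreteTopRep_ρ_apply, Subgroup.smul_def, htriv, sub_self] at hx
  exact hx

/-- **`conj_σ [z]` is unramified at `𝔮` iff `z` kills `σ⁻¹ (H ∩ I_𝔮) σ`** (trivial action: the principal
crossed homomorphisms vanish). [cite: GreenbergVatsal2000, §2 p. 17] [cite: SerreGaloisCohomology1997, I §5.1] -/
theorem conjH1_mem_unramifiedKer_iff_forall_eq_zero (htriv : ∀ (σ : absoluteGaloisGroup K) (m : M), σ • m = m)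
    (v : HeightOneSpectrum (𝓞 K)) (σ : absoluteGaloisGroup K) (z : contOneCocycles (discreteTopRep H M)) :
    conjH1 H M σ (oneCocycleClass _ z) ∈ unramifiedKer H M v ↔
      ∀ y : inertiaIn H v, z.1 (subgroupConj H σ (inertiaInToH H v y)) = 0 := by
  rw [conjH1_oneCocycleClass_mem_unramifiedKer_iff]
  constructor
  · rintro ⟨a, ha⟩ y
    have h := ha y
    rwa [htriv, htriv, sub_self] at h
  · intro h
    refine ⟨0, fun y ↦ ?_⟩
    rw [htriv, h y, smul_zero, sub_self]

end HomPicture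

/-! ## §2 The condition at `σ` depends only on the coset `(D_𝔮 · H) σ` -/

section Coset

variable {K : Type} [Field K] [NumberField K] (H : Subgroup (absoluteGaloisGroup K)) [hH : H.Normal]
  {M : Type} [AddCommGroup M]

/-- `I_𝔮` is normalised by `D_𝔮` (the local inertia group is normal in `Γ_{K_𝔮}`).
[cite: NeukirchANT1999, Ch. I §9 (Def. (9.5))] -/
theorem conj_mem_inertia_of_mem_decomp (v : HeightOneSpectrum (𝓞 K)) {δ y : absoluteGaloisGroup K}
    (hδ : δ ∈ decomp v) (hy : y ∈ inertia v) : δ⁻¹ * y * δ ∈ inertia v := by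
  obtain ⟨d, rfl⟩ := (mem_decomp_iff v δ).mp hδ
  obtain ⟨j, hj, rfl⟩ := hy
  haveI : (absInertia (v.adicCompletion K)).Normal := absInertia_normal_holds _
  refine ⟨d⁻¹ * j * d, ?_, by simp only [map_mul, map_inv]; rfl⟩
  have h := (inferInstance : (absInertia (v.adicCompletion K)).Normal).conj_mem j hj d⁻¹
  rwa [inv_inv] at h

/-- **Coset independence.** Let `Z : Γ_K → M` be additive on `H` (`Z(ab) = Z a + Z b` for `a, b ∈ H`). If `Z`
kills `τ⁻¹ y τ` for every `y ∈ H ∩ I_𝔮`, then it kills `σ⁻¹ y σ` for every `σ = δ h τ` with `δ ∈ D_𝔮`,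
`h ∈ H`: `σ⁻¹ y σ = k⁻¹ (τ⁻¹ (δ⁻¹ y δ) τ) k` with `k = τ⁻¹ h τ ∈ H` and `δ⁻¹ y δ ∈ H ∩ I_𝔮`.
[cite: NeukirchANT1999, Ch. I §9 Prop. (9.1)] -/
theorem forall_eq_zero_of_mem_decomp_mul (v : HeightOneSpectrum (𝓞 K)) (Z : absoluteGaloisGroup K → M)
    (hZ : ∀ a ∈ H, ∀ b ∈ H, Z (a * b) = Z a + Z b) {τ : absoluteGaloisGroup K}
    (hτ : ∀ y ∈ H, y ∈ inertia v → Z (τ⁻¹ * y * τ) = 0)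
    {δ h : absoluteGaloisGroup K} (hδ : δ ∈ decomp v) (hh : h ∈ H) :
    ∀ y ∈ H, y ∈ inertia v → Z ((δ * h * τ)⁻¹ * y * (δ * h * τ)) = 0 := by
  intro y hyH hyI
  have hZ1 : Z 1 = 0 := by
    have e := hZ 1 H.one_mem 1 H.one_mem
    rw [mul_one] at e
    exact left_eq_add.mp e
  have hZinv : ∀ a ∈ H, Z a⁻¹ = -Z a := fun a ha ↦ by
    have e := hZ a ha a⁻¹ (H.inv_mem ha)
    rw [mul_inv_cancel, hZ1] at e
    exact (neg_eq_of_add_eq_zero_right e.symm).symm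
  -- `y' = δ⁻¹ y δ ∈ H ∩ I_𝔮`, `w = τ⁻¹ y' τ ∈ H` is killed, `k = τ⁻¹ h τ ∈ H`
  set y' := δ⁻¹ * y * δ with hy'
  have hy'H : y' ∈ H := by
    have e := hH.conj_mem y hyH δ⁻¹
    rwa [inv_inv] at e
  have hy'I : y' ∈ inertia v := conj_mem_inertia_of_mem_decomp v hδ hyI
  set w := τ⁻¹ * y' * τ with hw
  have hwH : w ∈ H := by
    have e := hH.conj_mem y' hy'H τ⁻¹
    rwa [inv_inv] at e
  have hw0 : Z w = 0 := hτ y' hy'H hy'I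
  set k := τ⁻¹ * h * τ with hk
  have hkH : k ∈ H := by
    have e := hH.conj_mem h hh τ⁻¹
    rwa [inv_inv] at e
  have e : (δ * h * τ)⁻¹ * y * (δ * h * τ) = k⁻¹ * w * k := by
    simp only [hk, hw, hy', mul_inv_rev, inv_inv]
    group
  rw [e, hZ _ (H.mul_mem (H.inv_mem hkH) hwH) k hkH, hZ _ (H.inv_mem hkH) w hwH, hZinv k hkH, hw0]
  abel

end Coset

/-! ## §3 `S₀`-imprimitive from primitive -/

section Main

variable {K : Type} [Field K] [NumberField K] {p : ℕ} [Fact p.Prime] (κ : ZpExtension K p)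
  {M : Type} [AddCommGroup M] [DistribMulAction (absoluteGaloisGroup K) M] [TopologicalSpace M]
  [DiscreteTopology M] (L : Data K M p)

/-- The underlying element of `Γ_K` of `inertiaInToH H v y` is that of `y` (unfolding). [folklore] -/
theorem coe_inertiaInToH (H : Subgroup (absoluteGaloisGroup K)) (v : HeightOneSpectrum (𝓞 K))
    (y : inertiaIn H v) :
    ((inertiaInToH H v y : H) : absoluteGaloisGroup K) = ((y : decomp (K := K) v) : absoluteGaloisGroup K) :=
  rfl

/-- **`S₀`-IMPRIMITIVE FROM PRIMITIVE (trivial action).** Let `κ` be a `ℤ_p`-extension of the number field `K`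
(`H = ker κ = Gal(K̄/K_∞)`), `M` a discrete `Γ_K`-module with TRIVIAL action, `L` Greenberg data above `p` and
`S₀` a finite set of places such that every `𝔮 ∈ S₀` with `𝔮 ∤ p` is finitely decomposed in `K_∞`
(`(decomp 𝔮 ⊔ ker κ).FiniteIndex`) and carries only finitely many continuous additive `p`-torsion maps
`H ∩ I_𝔮 → M`. If the `p`-torsion of `S^{∅}_M(K_∞)` (`datumSelmerInfty κ M L ∅`) is finite, so is the `p`-torsion
of `S^{S₀}_M(K_∞)`: the additive map `c = [z_c] ↦ (y ↦ z_c(τ⁻¹ y τ))` over `𝔮 ∈ S₀`, `𝔮 ∤ p`, and coset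
representatives `τ` of `(D_𝔮 H)\Γ_K` takes finitely many values on `S^{S₀}[p]`, and a class on which it vanishes is
unramified at every conjugate above every such `𝔮` (§2), i.e. lies in `S^{∅}[p]`.
[cite: GreenbergVatsal2000, §2 pp. 16–17, 20] [cite: SerreGaloisCohomology1997, I §5.1] -/
theorem finite_pTorsion_datumSelmer_of_empty (htriv : ∀ (σ : absoluteGaloisGroup K) (m : M), σ • m = m)
    {S₀ : Set (HeightOneSpectrum (𝓞 K))} (hS₀ : S₀.Finite)
    (hdec : ∀ 𝔮 ∈ S₀, ((p : ℕ) : 𝓞 K) ∉ 𝔮.asIdeal → (decomp 𝔮 ⊔ κ.kerSubgroup).FiniteIndex)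
    (htame : ∀ 𝔮 ∈ S₀, ((p : ℕ) : 𝓞 K) ∉ 𝔮.asIdeal →
      Set.Finite {f : inertiaIn κ.kerSubgroup 𝔮 → M |
        Continuous f ∧ (∀ x y, f (x * y) = f x + f y) ∧ ∀ x, p • f x = 0})
    (hfin : Set.Finite {t : subgroupH1 κ.kerSubgroup M |
      t ∈ datumSelmerInfty κ M L (∅ : Set (HeightOneSpectrum (𝓞 K))) ∧ p • t = 0}) :
    Set.Finite {t : subgroupH1 κ.kerSubgroup M | t ∈ datumSelmerInfty κ M L S₀ ∧ p • t = 0} := by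
  classical
  set H : Subgroup (absoluteGaloisGroup K) := κ.kerSubgroup with hHdef
  haveI hHn : H.Normal := by
    rw [hHdef]
    change κ.toContinuousMonoidHom.toMonoidHom.ker.Normal
    infer_instance
  -- §3.1 the cocycle of a class (unique: trivial action)
  choose rep hrep using fun c : subgroupH1 H M ↦ oneCocycleClass_surjective (discreteTopRep H M) c
  have rep_add : ∀ c c' : subgroupH1 H M, rep (c + c') = rep c + rep c' := fun c c' ↦
    cocycle_eq_of_oneCocycleClass_eq H htriv (by rw [hrep, oneCocycleClass_add, hrep, hrep])
  have rep_zero : rep 0 = 0 :=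
    cocycle_eq_of_oneCocycleClass_eq H htriv (by rw [hrep, oneCocycleClass_zero])
  have rep_nsmul : ∀ (n : ℕ) (c : subgroupH1 H M), rep (n • c) = n • rep c := by
    intro n c
    induction n with
    | zero => rw [zero_smul, zero_smul, rep_zero]
    | succ n ih => rw [succ_nsmul, succ_nsmul, rep_add, ih]
  have rep_apply_eq_zero_of_nsmul : ∀ c : subgroupH1 H M, p • c = 0 → ∀ u : H, p • (rep c).1 u = 0 := by
    intro c hc u
    have h := congrArg (fun z : contOneCocycles (discreteTopRep H M) ↦ z.1 u) (rep_nsmul p c)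
    simp only [hc, rep_zero] at h
    -- `h : (0 : contOneCocycles _).1 u = (p • rep c).1 u`
    simp only [ZeroMemClass.coe_zero, ContinuousMap.zero_apply, AddSubmonoidClass.coe_nsmul,
      ContinuousMap.coe_nsmul, Pi.smul_apply] at h
    exact h.symm
  -- §3.2 index types: `S₀' = {𝔮 ∈ S₀, 𝔮 ∤ p}` and coset representatives of `D_𝔮 H`
  let ι : Type := {𝔮 : HeightOneSpectrum (𝓞 K) // 𝔮 ∈ S₀ ∧ ((p : ℕ) : 𝓞 K) ∉ 𝔮.asIdeal}
  haveI : Finite ι :=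
    (hS₀.subset (fun 𝔮 (h : 𝔮 ∈ S₀ ∧ ((p : ℕ) : 𝓞 K) ∉ 𝔮.asIdeal) ↦ h.1)).to_subtype
  let Q : ι → Subgroup (absoluteGaloisGroup K) := fun i ↦ decomp i.1 ⊔ H
  haveI hQ : ∀ i : ι, (Q i).FiniteIndex := fun i ↦ hdec i.1 i.2.1 i.2.2
  let τ : (i : ι) → (absoluteGaloisGroup K ⧸ Q i) → absoluteGaloisGroup K := fun i x ↦ (Quotient.out x)⁻¹
  have hcover : ∀ (i : ι) (σ : absoluteGaloisGroup K),
      ∃ x : absoluteGaloisGroup K ⧸ Q i, σ * (τ i x)⁻¹ ∈ Q i := by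
    intro i σ
    refine ⟨QuotientGroup.mk σ⁻¹, ?_⟩
    have e : (QuotientGroup.mk (Quotient.out (QuotientGroup.mk σ⁻¹ : absoluteGaloisGroup K ⧸ Q i)) :
        absoluteGaloisGroup K ⧸ Q i) = QuotientGroup.mk σ⁻¹ := QuotientGroup.out_eq' _
    rw [QuotientGroup.eq] at e
    simp only [τ, inv_inv]
    -- `e : (out ↑σ⁻¹)⁻¹ * σ⁻¹ ∈ Q i`; its inverse is `σ * out ↑σ⁻¹`
    have e' := (Q i).inv_mem e
    rwa [mul_inv_rev, inv_inv, inv_inv] at e'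
  -- §3.3 the additive map `Φ`
  let Φfun : subgroupH1 H M → ((i : ι) → (absoluteGaloisGroup K ⧸ Q i) → (inertiaIn H i.1 → M)) :=
    fun c i x y ↦ (rep c).1 (subgroupConj H (τ i x) (inertiaInToH H i.1 y))
  let Φ : subgroupH1 H M →+ ((i : ι) → (absoluteGaloisGroup K ⧸ Q i) → (inertiaIn H i.1 → M)) :=
    AddMonoidHom.mk' Φfun fun c c' ↦ by
      funext i x y
      simp only [Φfun, rep_add, Submodule.coe_add, ContinuousMap.add_apply, Pi.add_apply]
  -- §3.4 the finite target
  let T : (i : ι) → Set (inertiaIn H i.1 → M) := fun i ↦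
    {f | Continuous f ∧ (∀ x y, f (x * y) = f x + f y) ∧ ∀ x, p • f x = 0}
  have hT : ∀ i, (T i).Finite := fun i ↦ htame i.1 i.2.1 i.2.2
  have hTpi : (Set.univ.pi fun i : ι ↦ Set.univ.pi fun _ : absoluteGaloisGroup K ⧸ Q i ↦ T i).Finite :=
    Set.Finite.pi fun i ↦ Set.Finite.pi fun _ ↦ hT i
  -- §3.5 apply the counting dévissage
  refine finite_of_finite_image_of_finite_sub Φ (F₀ := {t : subgroupH1 H M |
      t ∈ datumSelmerInfty κ M L (∅ : Set (HeightOneSpectrum (𝓞 K))) ∧ p • t = 0}) ?_ ?_ hfin ?_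
  · -- closed under subtraction
    rintro a ⟨ha, hpa⟩ b ⟨hb, hpb⟩
    exact ⟨AddSubgroup.sub_mem _ ha hb, by rw [nsmul_sub, hpa, hpb, sub_zero]⟩
  · -- finite image
    refine hTpi.subset ?_
    rintro _ ⟨c, ⟨-, hpc⟩, rfl⟩
    simp only [Set.mem_univ_pi]
    intro i x
    refine ⟨?_, fun y y' ↦ ?_, fun y ↦ ?_⟩
    · exact (rep c).1.continuous.comp
        ((map_continuous (subgroupConj H (τ i x))).comp (map_continuous (inertiaInToH H i.1)))
    · change (rep c).1 (subgroupConj H (τ i x) (inertiaInToH H i.1 (y * y'))) = _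
      rw [map_mul, map_mul, TwoAdicGreenbergCotorsion.cocycle_mul_of_trivial htriv _]
      rfl
    · exact rep_apply_eq_zero_of_nsmul c hpc _
  · -- a class killed by `Φ` is unramified everywhere away from `p`: it lies in `S^{∅}[p]`
    rintro a ⟨ha, hpa⟩ hΦa
    refine ⟨?_, hpa⟩
    rw [datumSelmerInfty_eq, mem_datumSelmer_iff] at ha ⊢
    refine ⟨?_, ha.2⟩
    rw [mem_unramifiedOutside_iff]
    intro 𝔮 _ hp𝔮 σ
    by_cases h𝔮 : 𝔮 ∈ S₀
    swap
    · exact (mem_unramifiedOutside_iff _).mp ha.1 𝔮 h𝔮 hp𝔮 σ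
    let i : ι := ⟨𝔮, h𝔮, hp𝔮⟩
    rw [← hrep a, conjH1_mem_unramifiedKer_iff_forall_eq_zero H htriv]
    -- `Z` = the cocycle of `a` extended by `0` to `Γ_K`
    let Z : absoluteGaloisGroup K → M := fun g ↦ if hg : g ∈ H then (rep a).1 ⟨g, hg⟩ else 0
    have hZ_apply : ∀ u : H, Z u = (rep a).1 u := fun u ↦ by
      simp only [Z, SetLike.coe_mem, dif_pos, Subtype.coe_eta]
    have hZ : ∀ g ∈ H, ∀ g' ∈ H, Z (g * g') = Z g + Z g' := fun g hg g' hg' ↦ by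
      rw [show g * g' = ((⟨g, hg⟩ * ⟨g', hg'⟩ : H) : absoluteGaloisGroup K) from rfl, hZ_apply,
        TwoAdicGreenbergCotorsion.cocycle_mul_of_trivial htriv _, ← hZ_apply, ← hZ_apply]
    -- `σ = δ h τ`
    obtain ⟨x, hx⟩ := hcover i σ
    have hx' : σ * (τ i x)⁻¹ ∈ ((decomp 𝔮 : Set (absoluteGaloisGroup K)) * (H : Set (absoluteGaloisGroup K))) := by
      rw [← Subgroup.mul_normal]; exact hx
    obtain ⟨δ, hδ, h, hh, hδh⟩ := Set.mem_mul.mp hx'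
    have hσ : σ = δ * h * τ i x := by rw [hδh, inv_mul_cancel_right]
    -- the hypothesis `Φ a = 0` at `(i, x)`: `Z` kills `τ⁻¹ (H ∩ I_𝔮) τ`
    have hτ0 : ∀ y ∈ H, y ∈ inertia 𝔮 → Z ((τ i x)⁻¹ * y * τ i x) = 0 := by
      intro y hyH hyI
      let y' : inertiaIn H 𝔮 := ⟨⟨y, inertia_le_decomp 𝔮 hyI⟩, (mem_inertiaIn_iff H 𝔮 _).2 ⟨hyH, hyI⟩⟩
      have h0 : Φ a i x y' = 0 := by rw [hΦa]; rfl
      have e : (τ i x)⁻¹ * y * τ i x =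
          ((subgroupConj H (τ i x) (inertiaInToH H 𝔮 y') : H) : absoluteGaloisGroup K) := by
        rw [subgroupConj_apply_coe, coe_inertiaInToH]
      rw [e, hZ_apply]
      exact h0
    -- §2: hence `Z` kills `σ⁻¹ (H ∩ I_𝔮) σ`
    intro y
    have hyH : ((y : decomp (K := K) 𝔮) : absoluteGaloisGroup K) ∈ H := ((mem_inertiaIn_iff H 𝔮 _).1 y.2).1
    have hyI : ((y : decomp (K := K) 𝔮) : absoluteGaloisGroup K) ∈ inertia 𝔮 :=
      ((mem_inertiaIn_iff H 𝔮 _).1 y.2).2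
    have key := forall_eq_zero_of_mem_decomp_mul H 𝔮 Z hZ hτ0 hδ hh _ hyH hyI
    rw [← hσ] at key
    rw [← hZ_apply, subgroupConj_apply_coe, coe_inertiaInToH]
    exact key

end Main

/-! ## §4 The local supply: `p`-torsion maps on `H ∩ I_𝔮` from those on `I_{K_𝔮}` -/

section Local

variable {K : Type} [Field K] [NumberField K] (H : Subgroup (absoluteGaloisGroup K))
  {M : Type} [AddCommGroup M] [TopologicalSpace M]

/-- **Local supply.** If `I_𝔮 ≤ H` (the line is unramified at `𝔮`), the continuous additive `d`-torsion maps
`H ∩ I_𝔮 → M` inject (by pull-back along the surjection `I_{K_𝔮} ↠ I_𝔮 = H ∩ I_𝔮`) into the continuous additive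
`d`-torsion maps on the LOCAL inertia group `I_{K_𝔮} ≤ Γ_{K_𝔮}`; so finiteness of the latter (tame inertia is
pro-cyclic, `TameInertiaTorsionHomsFiniteProofs`) gives finiteness of the former.
[cite: SerreLocalFields1979, Ch. IV §2 Cor. 1 and Cor. 3 of Prop. 7] [cite: NeukirchANT1999, Ch. II §9 Prop. (9.6)] -/
theorem finite_torsionMaps_inertiaIn_of_local (v : HeightOneSpectrum (𝓞 K)) (hIH : inertia v ≤ H) {d : ℕ}
    (hloc : Set.Finite {g : ↥(absInertia (v.adicCompletion K)) → M |
      Continuous g ∧ (∀ x y, g (x * y) = g x + g y) ∧ ∀ x, d • g x = 0}) :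
    Set.Finite {f : inertiaIn H v → M | Continuous f ∧ (∀ x y, f (x * y) = f x + f y) ∧ ∀ x, d • f x = 0} := by
  -- the surjection `ψ : I_{K_𝔮} ↠ H ∩ I_𝔮`
  have hmemD : ∀ j : ↥(absInertia (v.adicCompletion K)),
      absGaloisRestrict K (v.adicCompletion K) (j : absoluteGaloisGroup (v.adicCompletion K)) ∈ decomp v :=
    fun j ↦ (mem_decomp_iff v _).2 ⟨j, rfl⟩
  have hmemI : ∀ j : ↥(absInertia (v.adicCompletion K)),
      absGaloisRestrict K (v.adicCompletion K) (j : absoluteGaloisGroup (v.adicCompletion K)) ∈ inertia v :=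
    fun j ↦ ⟨j, j.2, rfl⟩
  let ψ : ↥(absInertia (v.adicCompletion K)) → inertiaIn H v := fun j ↦
    ⟨⟨_, hmemD j⟩, (mem_inertiaIn_iff H v _).2 ⟨hIH (hmemI j), hmemI j⟩⟩
  have hψcont : Continuous ψ := by
    refine Continuous.subtype_mk (Continuous.subtype_mk ?_ _) _
    exact (map_continuous (absGaloisRestrict K (v.adicCompletion K))).comp continuous_subtype_val
  have hψmul : ∀ j j', ψ (j * j') = ψ j * ψ j' := fun j j' ↦
    Subtype.ext (Subtype.ext (by simp only [ψ, Subgroup.coe_mul, map_mul]))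
  have hψsurj : Function.Surjective ψ := by
    intro y
    obtain ⟨j, hj, hjy⟩ := ((mem_inertiaIn_iff H v _).1 y.2).2
    exact ⟨⟨j, hj⟩, Subtype.ext (Subtype.ext hjy)⟩
  -- pull-back is injective and lands in the local set
  refine Set.Finite.of_finite_image (f := fun f ↦ f ∘ ψ) (hloc.subset ?_) ?_
  · rintro _ ⟨f, ⟨hfc, hfm, hfd⟩, rfl⟩
    refine ⟨hfc.comp hψcont, fun j j' ↦ ?_, fun j ↦ hfd _⟩
    change f (ψ (j * j')) = f (ψ j) + f (ψ j')
    rw [hψmul, hfm]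
  · intro f _ f' _ hff'
    funext y
    obtain ⟨j, rfl⟩ := hψsurj y
    exact congrFun hff' j

end Local

end Summit.BirchSwinnertonDyer.BirchSwinnertonDyer.Theorems.TwoAdicBDPTrivialCharLine

end
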